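import Mathlib
import HarnessLib
import Summits.PneNP.PneNP.Theorems.CnfIdealGenLengthRankDefectRepresentationsTseitinTransferDefs

/-!
# Crux `RankDefectRepresentations` (stmt-PneNP-18923), line `rank-dehn-ladder`, stub `stub_tseitinTransfer`: the CNF side

Semantics and counting for the Tseitin CNF `tseitinCNF n N hN T` of `…TseitinTransferDefs` [Tseitin1968]:
* `not_satisfiable_tseitinCNF` — for a TAUTOLOGY `T` the Tseitin CNF (node clauses + the unit clause `¬y_root`) is
  unsatisfiable: any assignment satisfying the node clauses gives every node variable the value of its subformula
  (`eval_tseitinClauses`), so the root variable is `true` and the last clause fails;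
* `numClauses_tseitinCNF_le` (`≤ 3·size T + 1`), `size_tseitinCNF_le` (`≤ 3(3·size T + 1)`), `fst_lt_of_mem_tseitinClauses`
  (all variable indices `< n + size T`);
* `lt_size_of_subAt`, `size_le_of_subAt` — positions of subformula occurrences.
HONEST FRAMING: bookkeeping for one rung (the transfer stub) of the ladder skeleton; P ≠ NP is not moved; F-N2 is a FRONTIER
formal rung.
-/

set_option linter.dupNamespace false -- `Summit.PneNP.PneNP.…`: summit = sub-problem name (D-0017)

namespace Summit.PneNP.PneNP.Theorems.CnfIdealGenLengthRankDefectRepresentationsTseitinTransfer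

open Literature.Computability.Complexity
open Literature.Computability.MetaComplexity
open Literature.Computability.MetaComplexity.NCIPS

/-! ## Semantics of the Tseitin clauses (file …TseitinTransferCnf) -/

section Cnf

variable {n : ℕ}

/-- Evaluating a mapped CNF: relabelling literals along `g` on variables is evaluation at `σ ∘ g`. [folklore] -/
theorem eval_map_relabel {α β : Type*} (φ : CNF α) (g : α → β) (σ : β → Bool) :
    CNF.eval (φ.map fun κ => κ.map fun l => (g l.1, l.2)) σ = CNF.eval φ (fun a => σ (g a)) := by
  unfold CNF.eval
  simp only [List.all_map, Function.comp_def, List.any_map]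
  rfl

/-- The node clauses force the node variable to carry the truth value of the subformula. [cite: Tseitin1968, §1] -/
theorem eval_tseitinClauses (σ : ℕ → Bool) :
    ∀ (g : PropForm (Fin n)) (k : ℕ), CNF.eval (tseitinClauses n g k) σ = true →
      σ (n + k) = g.eval (fun i : Fin n => σ i)
  | .var i, k, h => by
      simp [tseitinClauses, CNF.eval, Literal.eval] at h
      simp only [PropForm.eval]
      rcases h with ⟨h1, h2⟩
      cases hk : σ (n + k) <;> cases hi : σ i <;> simp_all
  | .const true, k, h => by
      simp [tseitinClauses, CNF.eval, Literal.eval] at h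
      simpa [PropForm.eval] using h
  | .const false, k, h => by
      simp [tseitinClauses, CNF.eval, Literal.eval] at h
      simpa [PropForm.eval] using h
  | .neg g, k, h => by
      have h' := h
      simp only [tseitinClauses, CNF.eval, List.all_append, Bool.and_eq_true] at h'
      have ih := eval_tseitinClauses σ g (k + 1) (by simpa [CNF.eval] using h'.2)
      have h1 := h'.1
      simp [Literal.eval] at h1
      simp only [PropForm.eval]
      rw [← ih]
      rcases h1 with ⟨h1, h2⟩
      cases hk : σ (n + k) <;> cases hk1 : σ (n + (k + 1)) <;> simp_all
  | .conj a b, k, h => by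
      have h' := h
      simp only [tseitinClauses, CNF.eval, List.all_append, Bool.and_eq_true] at h'
      have iha := eval_tseitinClauses σ a (k + 1) (by simpa [CNF.eval] using h'.1.2)
      have ihb := eval_tseitinClauses σ b (k + 1 + a.size) (by simpa [CNF.eval] using h'.2)
      have h1 := h'.1.1
      simp [Literal.eval] at h1
      simp only [PropForm.eval]
      rw [← iha, ← ihb]
      rcases h1 with ⟨h1, h2, h3⟩
      cases hk : σ (n + k) <;> cases hk1 : σ (n + (k + 1)) <;> cases hk2 : σ (n + (k + 1 + a.size)) <;> simp_all
  | .disj a b, k, h => by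
      have h' := h
      simp only [tseitinClauses, CNF.eval, List.all_append, Bool.and_eq_true] at h'
      have iha := eval_tseitinClauses σ a (k + 1) (by simpa [CNF.eval] using h'.1.2)
      have ihb := eval_tseitinClauses σ b (k + 1 + a.size) (by simpa [CNF.eval] using h'.2)
      have h1 := h'.1.1
      simp [Literal.eval] at h1
      simp only [PropForm.eval]
      rw [← iha, ← ihb]
      rcases h1 with ⟨h1, h2, h3⟩
      cases hk : σ (n + k) <;> cases hk1 : σ (n + (k + 1)) <;> cases hk2 : σ (n + (k + 1 + a.size)) <;> simp_all

/-- For a tautology `T`, the ℕ-indexed Tseitin CNF (node clauses + `¬y_root`) has no satisfying assignment. [cite: Tseitin1968, §1] -/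
theorem eval_tseitinNat_eq_false {T : PropForm (Fin n)} (hT : T.IsTautology) (σ : ℕ → Bool) :
    CNF.eval (tseitinNat n T) σ = false := by
  by_contra h
  rw [Bool.not_eq_false] at h
  simp only [tseitinNat, CNF.eval, List.all_append, Bool.and_eq_true] at h
  have h1 : CNF.eval (tseitinClauses n T 0) σ = true := by simpa [CNF.eval] using h.1
  have hroot := eval_tseitinClauses σ T 0 h1
  have h2 := h.2
  simp [Literal.eval] at h2
  rw [Nat.add_zero, hT] at hroot
  rw [hroot] at h2
  exact Bool.noConfusion h2

/-- **The Tseitin CNF of a tautology is unsatisfiable** (on `Fin N`, any `N ≥ 1`). [cite: Tseitin1968, §1] -/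
theorem not_satisfiable_tseitinCNF {N : ℕ} (hN : 0 < N) {T : PropForm (Fin n)} (hT : T.IsTautology) :
    ¬ (tseitinCNF n N hN T).Satisfiable := by
  rintro ⟨σ, hσ⟩
  have key : CNF.eval (tseitinCNF n N hN T) σ =
      CNF.eval (tseitinNat n T) (fun m => σ ⟨m % N, Nat.mod_lt _ hN⟩) :=
    eval_map_relabel (tseitinNat n T) (fun m => (⟨m % N, Nat.mod_lt _ hN⟩ : Fin N)) σ
  rw [key, eval_tseitinNat_eq_false hT] at hσ
  exact Bool.noConfusion hσ

/-- The node clauses of `g` number at most `3 · size g`. [folklore] -/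
theorem length_tseitinClauses_le : ∀ (g : PropForm (Fin n)) (k : ℕ), (tseitinClauses n g k).length ≤ 3 * g.size
  | .var i, k => by simp [tseitinClauses, PropForm.size]
  | .const true, k => by simp [tseitinClauses, PropForm.size]
  | .const false, k => by simp [tseitinClauses, PropForm.size]
  | .neg g, k => by
      have := length_tseitinClauses_le g (k + 1)
      simp [tseitinClauses, PropForm.size]; omega
  | .conj a b, k => by
      have ha := length_tseitinClauses_le a (k + 1); have hb := length_tseitinClauses_le b (k + 1 + a.size)
      simp [tseitinClauses, PropForm.size]; omega
  | .disj a b, k => by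
      have ha := length_tseitinClauses_le a (k + 1); have hb := length_tseitinClauses_le b (k + 1 + a.size)
      simp [tseitinClauses, PropForm.size]; omega

/-- Every node clause has at most three literals. [folklore] -/
theorem length_le_three_of_mem_tseitinClauses :
    ∀ (g : PropForm (Fin n)) (k : ℕ), ∀ κ ∈ tseitinClauses n g k, κ.length ≤ 3
  | .var i, k, κ, hκ => by simp [tseitinClauses] at hκ; rcases hκ with rfl | rfl <;> simp
  | .const true, k, κ, hκ => by simp [tseitinClauses] at hκ; subst hκ; simp
  | .const false, k, κ, hκ => by simp [tseitinClauses] at hκ; subst hκ; simp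
  | .neg g, k, κ, hκ => by
      simp [tseitinClauses] at hκ
      rcases hκ with rfl | rfl | hκ
      · simp
      · simp
      · exact length_le_three_of_mem_tseitinClauses g (k + 1) κ hκ
  | .conj a b, k, κ, hκ => by
      simp [tseitinClauses] at hκ
      rcases hκ with rfl | rfl | rfl | hκ | hκ
      · simp
      · simp
      · simp
      · exact length_le_three_of_mem_tseitinClauses a (k + 1) κ hκ
      · exact length_le_three_of_mem_tseitinClauses b (k + 1 + a.size) κ hκ
  | .disj a b, k, κ, hκ => by
      simp [tseitinClauses] at hκ
      rcases hκ with rfl | rfl | rfl | hκ | hκ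
      · simp
      · simp
      · simp
      · exact length_le_three_of_mem_tseitinClauses a (k + 1) κ hκ
      · exact length_le_three_of_mem_tseitinClauses b (k + 1 + a.size) κ hκ

/-- A CNF whose clauses have at most three literals has size at most three times its number of clauses. [folklore] -/
theorem size_le_three_mul {ν : Type*} (φ : CNF ν) (h : ∀ κ ∈ φ, κ.length ≤ 3) : CNF.size φ ≤ 3 * φ.length := by
  unfold CNF.size
  induction φ with
  | nil => simp
  | cons κ φ ih =>
    have h1 := h κ (by simp)
    have h2 := ih (fun κ' hκ' => h κ' (by simp [hκ']))
    simp only [List.map_cons, List.sum_cons, List.length_cons]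
    omega

/-- Counting: the Tseitin CNF on `Fin N` has at most `3 · size T + 1` clauses. [folklore] -/
theorem numClauses_tseitinCNF_le {N : ℕ} (hN : 0 < N) (T : PropForm (Fin n)) :
    (tseitinCNF n N hN T).numClauses ≤ 3 * T.size + 1 := by
  simp only [CNF.numClauses, tseitinCNF, tseitinNat, List.length_map, List.length_append, List.length_singleton]
  have := length_tseitinClauses_le T 0
  omega

/-- Counting: the Tseitin CNF on `Fin N` has size at most `3 · (3 · size T + 1)`. [folklore] -/
theorem size_tseitinCNF_le {N : ℕ} (hN : 0 < N) (T : PropForm (Fin n)) :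
    (tseitinCNF n N hN T).size ≤ 3 * (3 * T.size + 1) := by
  have h3 : ∀ κ ∈ tseitinCNF n N hN T, κ.length ≤ 3 := by
    intro κ hκ
    simp only [tseitinCNF, tseitinNat, List.map_append, List.mem_append, List.mem_map, List.map_cons,
      List.map_nil, List.mem_singleton] at hκ
    rcases hκ with ⟨κ', hκ', rfl⟩ | rfl
    · rw [List.length_map]; exact length_le_three_of_mem_tseitinClauses T 0 κ' hκ'
    · simp
  refine (size_le_three_mul _ h3).trans ?_
  have := numClauses_tseitinCNF_le hN T
  simp only [CNF.numClauses] at this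
  omega

/-- Every variable index occurring in the node clauses of `g` (numbered from `n + k`) is `< n + k + size g`. [folklore] -/
theorem fst_lt_of_mem_tseitinClauses :
    ∀ (g : PropForm (Fin n)) (k : ℕ), ∀ κ ∈ tseitinClauses n g k, ∀ l ∈ κ, l.1 < n + k + g.size
  | .var i, k, κ, hκ, l, hl => by
      have hi := i.isLt
      simp [tseitinClauses] at hκ
      rcases hκ with rfl | rfl <;> simp at hl <;> rcases hl with rfl | rfl <;> simp only [PropForm.size] <;> omega
  | .const true, k, κ, hκ, l, hl => by
      simp [tseitinClauses] at hκ; subst hκ; simp at hl; subst hl; simp [PropForm.size]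
  | .const false, k, κ, hκ, l, hl => by
      simp [tseitinClauses] at hκ; subst hκ; simp at hl; subst hl; simp [PropForm.size]
  | .neg g, k, κ, hκ, l, hl => by
      have hg := PropForm.size_pos g
      simp [tseitinClauses] at hκ
      rcases hκ with rfl | rfl | hκ
      · simp at hl; rcases hl with rfl | rfl <;> simp only [PropForm.size] <;> omega
      · simp at hl; rcases hl with rfl | rfl <;> simp only [PropForm.size] <;> omega
      · have := fst_lt_of_mem_tseitinClauses g (k + 1) κ hκ l hl
        simp [PropForm.size]; omega
  | .conj a b, k, κ, hκ, l, hl => by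
      have hb := PropForm.size_pos b; have ha := PropForm.size_pos a
      simp [tseitinClauses] at hκ
      rcases hκ with rfl | rfl | rfl | hκ | hκ
      · simp at hl; rcases hl with rfl | rfl <;> simp only [PropForm.size] <;> omega
      · simp at hl; rcases hl with rfl | rfl <;> simp only [PropForm.size] <;> omega
      · simp at hl; rcases hl with rfl | rfl | rfl <;> simp only [PropForm.size] <;> omega
      · have := fst_lt_of_mem_tseitinClauses a (k + 1) κ hκ l hl
        simp [PropForm.size]; omega
      · have := fst_lt_of_mem_tseitinClauses b (k + 1 + a.size) κ hκ l hl
        simp [PropForm.size]; omega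
  | .disj a b, k, κ, hκ, l, hl => by
      have hb := PropForm.size_pos b; have ha := PropForm.size_pos a
      simp [tseitinClauses] at hκ
      rcases hκ with rfl | rfl | rfl | hκ | hκ
      · simp at hl; rcases hl with rfl | rfl | rfl <;> simp only [PropForm.size] <;> omega
      · simp at hl; rcases hl with rfl | rfl <;> simp only [PropForm.size] <;> omega
      · simp at hl; rcases hl with rfl | rfl <;> simp only [PropForm.size] <;> omega
      · have := fst_lt_of_mem_tseitinClauses a (k + 1) κ hκ l hl
        simp [PropForm.size]; omega
      · have := fst_lt_of_mem_tseitinClauses b (k + 1 + a.size) κ hκ l hl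
        simp [PropForm.size]; omega

end Cnf


/-! ## Positions of subformulas -/

section SubAt

/-- A position carrying a subformula lies inside the formula. [folklore] -/
theorem lt_size_of_subAt {ν : Type*} :
    ∀ (g : PropForm ν) (j : ℕ) (g' : PropForm ν), subAt g j = some g' → j < g.size
  | g, 0, _, _ => PropForm.size_pos g
  | .var _, _ + 1, _, h => by simp at h
  | .const _, _ + 1, _, h => by simp at h
  | .neg g, j + 1, g', h => by
      rw [subAt_neg_succ] at h
      have := lt_size_of_subAt g j g' h
      simp only [PropForm.size]; omega
  | .conj a b, j + 1, g', h => by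
      rw [subAt_conj_succ] at h
      split_ifs at h with hj
      · simp only [PropForm.size]; omega
      · have := lt_size_of_subAt b _ g' h
        simp only [PropForm.size]; omega
  | .disj a b, j + 1, g', h => by
      rw [subAt_disj_succ] at h
      split_ifs at h with hj
      · simp only [PropForm.size]; omega
      · have := lt_size_of_subAt b _ g' h
        simp only [PropForm.size]; omega

/-- A subformula occurrence is at most as large as the formula. [folklore] -/
theorem size_le_of_subAt {ν : Type*} :
    ∀ (g : PropForm ν) (j : ℕ) (g' : PropForm ν), subAt g j = some g' → g'.size ≤ g.size
  | g, 0, g', h => by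
      rw [subAt_zero, Option.some.injEq] at h
      rw [h]
  | .var _, _ + 1, _, h => by simp at h
  | .const _, _ + 1, _, h => by simp at h
  | .neg g, j + 1, g', h => by
      rw [subAt_neg_succ] at h
      have := size_le_of_subAt g j g' h
      simp only [PropForm.size]; omega
  | .conj a b, j + 1, g', h => by
      rw [subAt_conj_succ] at h
      split_ifs at h with hj
      · have := size_le_of_subAt a _ g' h
        simp only [PropForm.size]; omega
      · have := size_le_of_subAt b _ g' h
        simp only [PropForm.size]; omega
  | .disj a b, j + 1, g', h => by
      rw [subAt_disj_succ] at h
      split_ifs at h with hj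
      · have := size_le_of_subAt a _ g' h
        simp only [PropForm.size]; omega
      · have := size_le_of_subAt b _ g' h
        simp only [PropForm.size]; omega

end SubAt

end Summit.PneNP.PneNP.Theorems.CnfIdealGenLengthRankDefectRepresentationsTseitinTransfer
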